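import Literature.Analysis.FluidPDE.StatisticalSolution
import Literature.Analysis.FunctionSpaces.TorusTrigPoly
import Literature.Analysis.FunctionSpaces.TorusTestFunction
import HarnessLib

/-!
# Crux `TaylorCertificates.TaylorFloor` (stmt-AnomalousDissipation-14085) — crux-ideate round 1, ideator 3

VERDICT SUPPORT FILE (no positive lever exists; see the memo `VERDICT-r1-3.md`). v2 (self-contained): the route decl
`Summit.AnomalousDissipation.AnomalousDissipation.Theses.TaylorCertificates.TaylorFloor` was DROPPED in route rev 6 (2026-08-16T00:46:45Z,
item stmt-14085 closed `moot`), so this file no longer imports the route module; `TaylorFloor` below is the item's signature VERBATIM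
(`∃ f, admissible ∧ <body>`), split as `∃ f, admissible ∧ TaylorFloorFor f` (`taylorFloor_iff`, definitional).

* `TaylorFloorFor f` — the per-force clause, with `taylorFloor_iff` (PROVED): the crux is `∃ f, admissible ∧ TaylorFloorFor f`;
* `HasStandingFlow f` — (E_f) a forced standing flow of `f` in the MINIMAL form the phantom kill uses: `v ∈ L²` (not `L^∞`),
  weakly divergence free, mean zero, weak forced stationary Euler against smooth divergence-free tests, `(f, v) ≥ 0`;
  `ForcedStandingFlows := ∀ admissible f, HasStandingFlow f` — (E∀), the forced corollary of Choffrut–Székelyhidi 2014 Thm 1,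
  whose UNFORCED form is now PROVED in the tree (`Torus.ChoffrutSzekelyhidi2014_thm1_holds`, 2026-08-16T00:02Z);
* `PacketLemma` — (P), verbatim the typed form of Cruxes/TaylorCertificatePair/SketchIdeator4.lean (that file no longer
  elaborates: it refers to the retired decl `TaylorCertificatePair`);
* `FloorPhantomKillFor f` / `FloorPhantomKill` — the `∀∃` negations, and the glue PROVED:
  `not_taylorFloorFor_of_kill`, `not_taylorFloor_of_kill : FloorPhantomKill → ¬ TaylorFloor` (the route decl, by name);
* `PhantomTheoremFor f : HasStandingFlow f → PacketLemma → FloorPhantomKillFor f` and `PhantomTheorem` (stated; paper proof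
  PHANTOM-FLOOR.md §2, re-derived in VERDICT-r1-3.md §2) — the disprover's analytic target, M-sized GIVEN (E_f) and (P).
-/

noncomputable section

open MeasureTheory
open scoped InnerProductSpace ENNReal

namespace Summit.AnomalousDissipation.AnomalousDissipation.Cruxes.TaylorFloor.Ideator3

open Literature.Analysis.FunctionSpaces Literature.Analysis.FluidPDE

local notation "𝕋³" => UnitAddTorus (Fin 3)
local notation "E³" => EuclideanSpace ℝ (Fin 3)
local notation "L2T" => Lp (EuclideanSpace ℝ (Fin 3)) 2 (volume : Measure (UnitAddTorus (Fin 3)))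

/-- The Taylor-class FLOOR clause for ONE force `f` (the body of the route decl `TaylorFloor` after its `∃ f`). -/
def TaylorFloorFor (f : 𝕋³ → E³) : Prop :=
  ∃ (ε₀ C Θ ν₀ : ℝ), 0 < ε₀ ∧ 0 < ν₀ ∧ ∀ ν : ℝ, 0 < ν → ν < ν₀ →
    ∃ (N : ℕ) (Φ₁ : Torus.CylindricalTest (Fin 3)) (θ₁ : ℝ), (N : ℝ) ≤ C * ν ^ (-(1 / 2 : ℝ)) ∧
    (∀ i, Torus.fourierTruncate N (Φ₁.g i) = Φ₁.g i) ∧ -Θ ≤ θ₁ ∧ θ₁ ≤ 0 ∧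
    ∀ u : Torus.energySpace (Fin 3),
      let uf : 𝕋³ → E³ := ((u : L2T) : 𝕋³ → E³);
      let D : ℝ := ν * (Torus.eGradNormSq uf).toReal;
      let P : ℝ := Torus.pairing (u : L2T) f - D;
      Torus.eGradNormSq uf ≠ ⊤ → ‖u‖ ^ 2 ≤ 16 * (∫ x, ‖f x‖ ^ 2) / ν ^ 2 →
      ε₀ ≤ D + Torus.nsGeneratorPairing ν f u (Φ₁.grad u) + 2 * θ₁ * P

/-- The item's statement, VERBATIM the signature of stmt-AnomalousDissipation-14085 (= the dropped route decl
`TaylorCertificates.TaylorFloor`, rev 5). -/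
def TaylorFloor : Prop :=
  ∃ f : 𝕋³ → E³, Torus.IsSmooth f ∧ Torus.IsDivFree f ∧ Torus.HasZeroMean f ∧
    ∃ (ε₀ C Θ ν₀ : ℝ), 0 < ε₀ ∧ 0 < ν₀ ∧ ∀ ν : ℝ, 0 < ν → ν < ν₀ →
    ∃ (N : ℕ) (Φ₁ : Torus.CylindricalTest (Fin 3)) (θ₁ : ℝ), (N : ℝ) ≤ C * ν ^ (-(1 / 2 : ℝ)) ∧
    (∀ i, Torus.fourierTruncate N (Φ₁.g i) = Φ₁.g i) ∧ -Θ ≤ θ₁ ∧ θ₁ ≤ 0 ∧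
    ∀ u : Torus.energySpace (Fin 3),
      let uf : 𝕋³ → E³ := ((u : L2T) : 𝕋³ → E³);
      let D : ℝ := ν * (Torus.eGradNormSq uf).toReal;
      let P : ℝ := Torus.pairing (u : L2T) f - D;
      Torus.eGradNormSq uf ≠ ⊤ → ‖u‖ ^ 2 ≤ 16 * (∫ x, ‖f x‖ ^ 2) / ν ^ 2 →
      ε₀ ≤ D + Torus.nsGeneratorPairing ν f u (Φ₁.grad u) + 2 * θ₁ * P

/-- The crux is the per-force clause for SOME admissible force (definitional). -/
theorem taylorFloor_iff :
    TaylorFloor ↔ ∃ f : 𝕋³ → E³, Torus.IsSmooth f ∧ Torus.IsDivFree f ∧ Torus.HasZeroMean f ∧ TaylorFloorFor f :=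
  Iff.rfl

/-- **(E_f) a forced standing flow of `f`, minimal form**: `v ∈ L²(T³)`, weakly divergence free, mean zero, a weak
STATIONARY Euler flow driven by `f` — `∫ (v ⊗ v) : ∇w + (f, w) = 0` for every smooth divergence-free `w` — on which the
force does non-negative work. (Only these clauses enter the phantom kill: PHANTOM-FLOOR.md §2 Remark (a).) -/
def HasStandingFlow (f : 𝕋³ → E³) : Prop :=
  ∃ v : 𝕋³ → E³, MemLp v 2 volume ∧ Torus.IsWeaklyDivFree v ∧ Torus.HasZeroMean v ∧
    (∀ w : 𝕋³ → E³, Torus.IsSmooth w → Torus.IsDivFree w →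
      ∫ x, (⟪v x, Torus.convect v w x⟫_ℝ + ⟪f x, w x⟫_ℝ) = 0) ∧
    0 ≤ ∫ x, ⟪f x, v x⟫_ℝ

/-- **(E∀) forced standing flows for every admissible force** — the forced corollary of Choffrut–Székelyhidi 2014,
Thm 1 (arXiv:1401.4301; unforced form PROVED in the tree as `Torus.ChoffrutSzekelyhidi2014_thm1_holds`): run the SAME
iteration from the smooth strict subsolution `(v̄, ū) = (δ f, ∇Δ⁻¹f + (∇Δ⁻¹f)ᵀ)` of the affine linear system
`div v̄ = 0`, `div ū + ∇q̄ = f` (every correction solves the homogeneous system and has integral zero). UNPROVED in Lean: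
needs the affine generalisation of `StationaryEuler.IsTorusSub` / `MemX0` / `IterData` (VERDICT-r1-3.md §3). -/
def ForcedStandingFlows : Prop :=
  ∀ f : 𝕋³ → E³, Torus.IsSmooth f → Torus.IsDivFree f → Torus.HasZeroMean f → HasStandingFlow f

/-- **(P) packet lemma** (verbatim the typed form of the predecessor crux's SketchIdeator4.lean; elementary, exact numerics
10/10 in PHANTOM-FLOOR.md §5; UNPROVED in Lean, size L). -/
def PacketLemma : Prop :=
  ∃ K₁ : ℕ, ∀ D : ℕ, 1 ≤ D → ∀ W : 𝕋³ → E³, Torus.IsSmooth W → Torus.IsDivFree W →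
    Torus.fourierTruncate D W = W → ∀ s : ℝ,
    (∀ (x : 𝕋³) (η : E³), ‖η‖ = 1 → |⟪η, Torus.convect (fun _ => η) W x⟫_ℝ| ≤ s) →
    ∀ (x₀ : 𝕋³) (ξ : E³), ‖ξ‖ = 1 →
      ∃ ŵ : 𝕋³ → E³, Torus.IsSmooth ŵ ∧ Torus.IsDivFree ŵ ∧ Torus.HasZeroMean ŵ ∧
        Torus.fourierTruncate (2 * D) ŵ = 0 ∧ Torus.fourierTruncate (K₁ * D) ŵ = ŵ ∧
        ∫ x, ‖ŵ x‖ ^ 2 = 1 ∧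
        ∫ x, ⟪ŵ x, Torus.convect ŵ W x⟫_ℝ ≤ ⟪ξ, Torus.convect (fun _ => ξ) W x₀⟫_ℝ + s / 4

/-- **Floor killed for the force `f`** (the `∀∃`-form of `¬ TaylorFloorFor f`): for all constants there are arbitrarily
small `ν` at which EVERY admissible `(N, Φ₁, θ₁)` is violated by a finite-enstrophy state of the Leray ball. -/
def FloorPhantomKillFor (f : 𝕋³ → E³) : Prop :=
  ∀ (ε₀ C Θ ν₀ : ℝ), 0 < ε₀ → 0 < ν₀ → ∃ ν : ℝ, 0 < ν ∧ ν < ν₀ ∧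
    ∀ (N : ℕ) (Φ₁ : Torus.CylindricalTest (Fin 3)) (θ₁ : ℝ), (N : ℝ) ≤ C * ν ^ (-(1 / 2 : ℝ)) →
    (∀ i, Torus.fourierTruncate N (Φ₁.g i) = Φ₁.g i) → -Θ ≤ θ₁ → θ₁ ≤ 0 →
    ∃ u : Torus.energySpace (Fin 3),
      let uf : 𝕋³ → E³ := ((u : L2T) : 𝕋³ → E³);
      let D : ℝ := ν * (Torus.eGradNormSq uf).toReal;
      let P : ℝ := Torus.pairing (u : L2T) f - D;
      Torus.eGradNormSq uf ≠ ⊤ ∧ ‖u‖ ^ 2 ≤ 16 * (∫ x, ‖f x‖ ^ 2) / ν ^ 2 ∧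
      D + Torus.nsGeneratorPairing ν f u (Φ₁.grad u) + 2 * θ₁ * P < ε₀

/-- The kill for every admissible force. -/
def FloorPhantomKill : Prop :=
  ∀ f : 𝕋³ → E³, Torus.IsSmooth f → Torus.IsDivFree f → Torus.HasZeroMean f → FloorPhantomKillFor f

/-- Glue (pure logic), per force. -/
theorem not_taylorFloorFor_of_kill {f : 𝕋³ → E³} (hK : FloorPhantomKillFor f) : ¬ TaylorFloorFor f := by
  rintro ⟨ε₀, C, Θ, ν₀, hε₀, hν₀, h⟩
  obtain ⟨ν, hν, hνν₀, hkill⟩ := hK ε₀ C Θ ν₀ hε₀ hν₀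
  obtain ⟨N, Φ₁, θ₁, hN, hΦ₁, hθ₁, hθ₁', hu⟩ := h ν hν hνν₀
  obtain ⟨u, hfin, hball, hlt⟩ := hkill N Φ₁ θ₁ hN hΦ₁ hθ₁ hθ₁'
  exact absurd (hu u hfin hball) (not_le.mpr hlt)

/-- Glue (pure logic): the kill statement refutes the item's statement. -/
theorem not_taylorFloor_of_kill (hK : FloorPhantomKill) : ¬ TaylorFloor := by
  rintro ⟨f, hfs, hfd, hfz, hfloor⟩
  exact not_taylorFloorFor_of_kill (hK f hfs hfd hfz) hfloor

/-- The analytic theorem of the negative line, per force (paper proof: PHANTOM-FLOOR.md §2 = VERDICT-r1-3.md §2):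
a standing flow of `f` and the packet lemma kill every Taylor-class floor certificate for `f`. Stated, not proved. -/
def PhantomTheoremFor (f : 𝕋³ → E³) : Prop :=
  Torus.IsSmooth f → Torus.IsDivFree f → Torus.HasZeroMean f → HasStandingFlow f → PacketLemma → FloorPhantomKillFor f

/-- The theorem of the negative line for every force. -/
def PhantomTheorem : Prop :=
  ForcedStandingFlows → PacketLemma → FloorPhantomKill

/-- Bookkeeping: the per-force theorems assemble the global one. -/
theorem phantomTheorem_of_forall (h : ∀ f, PhantomTheoremFor f) : PhantomTheorem :=
  fun hE hP f hfs hfd hfz => h f hfs hfd hfz (hE f hfs hfd hfz) hP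

/-- Hence, GIVEN the two inputs, the crux is false (the shape a `Negative/` lemma `TaylorFloor_false_of_…` would take). -/
theorem not_taylorFloor_of_inputs (h : ∀ f, PhantomTheoremFor f) (hE : ForcedStandingFlows) (hP : PacketLemma) :
    ¬ TaylorFloor :=
  not_taylorFloor_of_kill (phantomTheorem_of_forall h hE hP)

end Summit.AnomalousDissipation.AnomalousDissipation.Cruxes.TaylorFloor.Ideator3
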